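import Literature.Barriers.NavierStokesRegularity.NavierStokesInequalityPressureSymmetry
import Literature.Analysis.FluidPDE.SwirlCutoff
import HarnessLib

/-!
# Calculus of the fields `u[v,f]`, I: smoothness, support, divergence (Ożański, Lemma 3.1 (i))

Barrier catalogue support file for `NavierStokesRegularity` (D-0021), on the decomposition path
of `Literature.Barriers.NavierStokesRegularity.NSIBlock_of_arrangement` (fact D of
`NavierStokesInequalityArrangement`; Ożański, arXiv:1709.00602v4, §4). Proposition 4.2 there
asserts that `u(t) = u[a₁ᵏ(t)v₁, q₁ᵏ_t] + u[a₂ᵏ(t)v₂, q₂ᵏ_t]` is smooth, compactly supported in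
`G = R(Ū₁ ∪ Ū₂)` and divergence free, quoting §3.3–§3.4: "it is clear that `u[v,f] ∈ C_0^∞`",
"`supp u[v,f] ⊆ R(Ū)`", and Lemma 3.1 (i): "`u[v,f]` is divergence free if and only if
`div(x₂ v) = 0`", "given `(v,f,φ)`, a structure on `U`, the velocity field `u[v,f]` is divergence
free and is supported in `R(Ū)`" (after Definition 3.3). This file proves these for the tree's
rendering `swirlField v f` (`u[v,f] = v_r ρ̂ + v_z x̂_axis + √(f² - |v|²) φ̂`, meridian
coordinates `q = (r,z) = meridian x`):

* `contDiff_comp_meridian_of_eq_zero` — a smooth planar profile vanishing for `r < r₀` lifts to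
  a smooth axisymmetric function on `ℝ³` (smooth off the axis by the chain rule, zero near it);
* `IsNSIStructure.exists_axis_margin` — a structure stays at distance `r₀ > 0` from the axis;
* `IsNSIStructure.contDiff_swirlField` — **`u[v,f] ∈ C^∞(ℝ³; ℝ³)`**;
* `IsNSIStructure.tsupport_swirlField_subset`, `….hasCompactSupport_swirlField` —
  **`supp u[v,f] ⊆ R(Ū)`**, compact;
* `divergence_swirlField` — off the axis, **`div u[v,f] = v_r/r + ∂ᵣv_r + ∂_z v_z`**
  `= r⁻¹ (∂ᵣ(r v_r) + ∂_z(r v_z))` (Lemma 3.1 (i): `div u = ∂_{x₁}u₁ + ρ⁻¹∂_ρ(ρ u_ρ) + ρ⁻¹∂_φ u_φ`);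
* `IsNSIStructure.isDivFree_swirlField` — **`div u[v,f] = 0`** for a structure.

Technique: `ρ̂ = r⁻¹ (x₀,x₁,0)`, `φ̂ = r⁻¹ Jx` (`J = Fluid.rotGen`), the Leibniz rule
`div(θ w) = θ div w + ⟪w, ∇θ⟫` (`divergence_smul_apply`), the chain rule through the meridian
coordinates (`fderiv_comp_meridian_apply`), `div (x₀,x₁,0) = 2`, `div J = 0`, `div ρ̂ = 1/r`,
`div φ̂ = 0`.

## References

* W. S. Ożański, arXiv:1709.00602v4, §3.3 ((3.10)–(3.12), Lemma 3.1 (i)), §3.4 (after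
  Definition 3.3). [`Ozanski2017NSISingular`] (Held plain-text rendering: "Lemma 3",
  "Definition 5".)
-/

noncomputable section

open MeasureTheory Set Function Filter Topology TopologicalSpace WithLp Metric
open scoped ENNReal InnerProductSpace RealInnerProductSpace ContDiff

namespace Literature.Barriers.NavierStokesRegularity

open Literature.Analysis.FluidPDE

variable {v : ℝ × ℝ → ℝ × ℝ} {f φ : ℝ × ℝ → ℝ} {U : Set (ℝ × ℝ)}

/-! ### Lifting planar profiles to `ℝ³` -/

/-- The meridian projection is smooth off the axis. [folklore] -/
theorem contDiffAt_meridian {x : EuclideanSpace ℝ (Fin 3)} (hx : cylRadius x ≠ 0)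
    {n : WithTop ℕ∞} : ContDiffAt ℝ n meridian x :=
  (contDiffAt_cylRadius hx).prodMk
    (EuclideanSpace.proj (2 : Fin 3) : EuclideanSpace ℝ (Fin 3) →L[ℝ] ℝ).contDiff.contDiffAt

/-- **Lifting**: a `Cⁿ` planar profile `G` vanishing for `r < r₀` (`r₀ > 0`) gives a `Cⁿ`
function `G ∘ meridian` on `ℝ³` (smooth off the axis by the chain rule, identically zero on the
open neighbourhood `{r < r₀}` of the axis). [folklore] -/
theorem contDiff_comp_meridian_of_eq_zero {F : Type*} [NormedAddCommGroup F] [NormedSpace ℝ F]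
    {G : ℝ × ℝ → F} {n : WithTop ℕ∞} (hG : ContDiff ℝ n G) {r₀ : ℝ} (hr₀ : 0 < r₀)
    (h0 : ∀ q : ℝ × ℝ, q.1 < r₀ → G q = 0) :
    ContDiff ℝ n fun x : EuclideanSpace ℝ (Fin 3) => G (meridian x) := by
  refine contDiff_iff_contDiffAt.2 fun x => ?_
  by_cases hx : cylRadius x < r₀
  · have ho : IsOpen {y : EuclideanSpace ℝ (Fin 3) | cylRadius y < r₀} :=
      isOpen_lt continuous_cylRadius continuous_const
    have heq : (fun y : EuclideanSpace ℝ (Fin 3) => G (meridian y)) =ᶠ[𝓝 x] fun _ => 0 := by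
      filter_upwards [ho.mem_nhds hx] with y hy using h0 _ hy
    exact (contDiffAt_const (c := (0 : F))).congr_of_eventuallyEq heq
  · have hx' : cylRadius x ≠ 0 := by
      intro h
      exact hx (h ▸ hr₀)
    exact hG.contDiffAt.comp x (contDiffAt_meridian hx')

/-- A planar profile vanishing for `r < r₀`, divided by `r`, is still smooth and still vanishes
for `r < r₀`. [folklore] -/
theorem contDiff_mul_inv_fst_of_eq_zero {g : ℝ × ℝ → ℝ} {n : WithTop ℕ∞} (hg : ContDiff ℝ n g)
    {r₀ : ℝ} (hr₀ : 0 < r₀) (h0 : ∀ q : ℝ × ℝ, q.1 < r₀ → g q = 0) :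
    ContDiff ℝ n fun q : ℝ × ℝ => g q * q.1⁻¹ := by
  refine contDiff_iff_contDiffAt.2 fun q => ?_
  by_cases hq : q.1 < r₀
  · have ho : IsOpen {q' : ℝ × ℝ | q'.1 < r₀} := isOpen_lt continuous_fst continuous_const
    have heq : (fun q' : ℝ × ℝ => g q' * q'.1⁻¹) =ᶠ[𝓝 q] fun _ => 0 := by
      filter_upwards [ho.mem_nhds hq] with q' hq'
      rw [h0 _ hq', zero_mul]
    exact (contDiffAt_const (c := (0 : ℝ))).congr_of_eventuallyEq heq
  · have hq' : q.1 ≠ 0 := by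
      intro h
      exact hq (h ▸ hr₀)
    exact hg.contDiffAt.mul (contDiffAt_fst.inv hq')

/-! ### Structures stay away from the axis; smoothness of the profiles of `u[v,f]` -/

namespace IsNSIStructure

/-- **A structure keeps a positive distance from the axis**: there is `r₀ > 0` with `r ≥ r₀` on
`Ū` (`Ū ⊆ P = {r > 0}` is compact). [folklore] -/
theorem exists_axis_margin (h : IsNSIStructure U v f φ) : ∃ r₀ > 0, ∀ q ∈ closure U, r₀ ≤ q.1 := by
  rcases (closure U).eq_empty_or_nonempty with hU | hU
  · exact ⟨1, one_pos, fun q hq => by simp [hU] at hq⟩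
  · obtain ⟨q₀, hq₀, hmin⟩ := h.isCompact_closure.exists_isMinOn hU continuous_fst.continuousOn
    exact ⟨q₀.1, h.closure_subset hq₀, fun q hq => hmin hq⟩

/-- Below the margin all the data vanish: `f = 0` and `v = 0` for `r < r₀`. [folklore] -/
theorem exists_axis_margin' (h : IsNSIStructure U v f φ) :
    ∃ r₀ > 0, ∀ q : ℝ × ℝ, q.1 < r₀ → f q = 0 ∧ v q = 0 := by
  obtain ⟨r₀, hr₀, hr⟩ := h.exists_axis_margin
  refine ⟨r₀, hr₀, fun q hq => ?_⟩
  have hq' : q ∉ closure U := fun h' => (hr q h').not_gt hq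
  exact ⟨h.f_eq_zero hq', h.v_eq_zero hq'⟩

/-- **The swirl profile `√(f² - |v|²)` of a structure is smooth** (positive radicand on `U`,
where `f > |v|`; equal to `f` off `supp v`). [cite: Ozanski2017NSISingular, §3.3 (after (3.12))] -/
theorem contDiff_sqrt (h : IsNSIStructure U v f φ) :
    ContDiff ℝ ∞ fun q : ℝ × ℝ => Real.sqrt (f q ^ 2 - ((v q).1 ^ 2 + (v q).2 ^ 2)) := by
  have hv1 : ContDiff ℝ ∞ fun q => (v q).1 := contDiff_fst.comp h.v_smooth
  have hv2 : ContDiff ℝ ∞ fun q => (v q).2 := contDiff_snd.comp h.v_smooth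
  have hR : ContDiff ℝ ∞ fun q => f q ^ 2 - ((v q).1 ^ 2 + (v q).2 ^ 2) :=
    (h.f_smooth.pow 2).sub ((hv1.pow 2).add (hv2.pow 2))
  refine contDiff_iff_contDiffAt.2 fun q => ?_
  by_cases hq : q ∈ U
  · exact hR.contDiffAt.sqrt (sub_pos.2 (h.sq_lt q hq)).ne'
  · have hq' : q ∉ tsupport v := fun h' => hq (h.tsupport_v_subset h')
    have heq : (fun q' : ℝ × ℝ => Real.sqrt (f q' ^ 2 - ((v q').1 ^ 2 + (v q').2 ^ 2))) =ᶠ[𝓝 q]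
        f := by
      filter_upwards [(isClosed_tsupport v).isOpen_compl.mem_nhds hq'] with q' hq''
      rw [image_eq_zero_of_notMem_tsupport hq'']
      simp [Real.sqrt_sq (h.f_nonneg q')]
    exact h.f_smooth.contDiffAt.congr_of_eventuallyEq heq

end IsNSIStructure

/-! ### `u[v,f]` in terms of the linear fields `(x₀,x₁,0)` and `Jx`; smoothness and support -/

/-- **`u[v,f]` in terms of linear fields**: `u[v,f](x) = (v_r/r)(q)·(x₀,x₁,0) + v_z(q)·x̂_axis +
(√(f²-|v|²)/r)(q)·Jx`, `q = meridian x`, `r = cylRadius x` (since `ρ̂ = r⁻¹(x₀,x₁,0)`,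
`φ̂ = r⁻¹Jx`); valid at every `x` (both sides vanish on the axis where the data do). [folklore] -/
theorem swirlField_eq_linear (v : ℝ × ℝ → ℝ × ℝ) (f : ℝ × ℝ → ℝ) :
    swirlField v f = fun x : EuclideanSpace ℝ (Fin 3) =>
      ((v (meridian x)).1 * (meridian x).1⁻¹) • (toLp 2 ![x 0, x 1, 0] : EuclideanSpace ℝ (Fin 3)) +
        (v (meridian x)).2 • eZ +
        (Real.sqrt (f (meridian x) ^ 2 - ((v (meridian x)).1 ^ 2 + (v (meridian x)).2 ^ 2)) *
          (meridian x).1⁻¹) • rotGen x := by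
  funext x
  simp only [swirlField, eR, eTheta, rotGen, smul_smul, meridian_apply, mul_comm]

/-- The horizontal projection `x ↦ (x₀, x₁, 0)` is smooth (it is linear). [folklore] -/
theorem contDiff_horizontal {n : WithTop ℕ∞} :
    ContDiff ℝ n fun x : EuclideanSpace ℝ (Fin 3) =>
      (toLp 2 ![x 0, x 1, 0] : EuclideanSpace ℝ (Fin 3)) := by
  rw [contDiff_euclidean]
  intro i
  fin_cases i
  · exact (EuclideanSpace.proj (0 : Fin 3) : EuclideanSpace ℝ (Fin 3) →L[ℝ] ℝ).contDiff
  · exact (EuclideanSpace.proj (1 : Fin 3) : EuclideanSpace ℝ (Fin 3) →L[ℝ] ℝ).contDiff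
  · exact contDiff_const

namespace IsNSIStructure

/-- **`u[v,f] ∈ C^∞(ℝ³; ℝ³)` for a structure** (Ożański §3.3: "it is clear that
`u[v,f] ∈ C_0^∞(ℝ³; ℝ³)`"). [cite: Ozanski2017NSISingular, §3.3 (after (3.12))] -/
theorem contDiff_swirlField (h : IsNSIStructure U v f φ) : ContDiff ℝ ∞ (swirlField v f) := by
  obtain ⟨r₀, hr₀, h0⟩ := h.exists_axis_margin'
  have hv1 : ContDiff ℝ ∞ fun q => (v q).1 := contDiff_fst.comp h.v_smooth
  have hv2 : ContDiff ℝ ∞ fun q => (v q).2 := contDiff_snd.comp h.v_smooth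
  have hα : ContDiff ℝ ∞ fun x : EuclideanSpace ℝ (Fin 3) =>
      (v (meridian x)).1 * (meridian x).1⁻¹ :=
    contDiff_comp_meridian_of_eq_zero (G := fun q => (v q).1 * q.1⁻¹)
      (contDiff_mul_inv_fst_of_eq_zero hv1 hr₀ fun q hq => by simp [(h0 q hq).2]) hr₀
      fun q hq => by simp [(h0 q hq).2]
  have hβ : ContDiff ℝ ∞ fun x : EuclideanSpace ℝ (Fin 3) => (v (meridian x)).2 :=
    contDiff_comp_meridian_of_eq_zero (G := fun q => (v q).2) hv2 hr₀
      fun q hq => by simp [(h0 q hq).2]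
  have hγ : ContDiff ℝ ∞ fun x : EuclideanSpace ℝ (Fin 3) =>
      Real.sqrt (f (meridian x) ^ 2 - ((v (meridian x)).1 ^ 2 + (v (meridian x)).2 ^ 2)) *
        (meridian x).1⁻¹ :=
    contDiff_comp_meridian_of_eq_zero
      (G := fun q => Real.sqrt (f q ^ 2 - ((v q).1 ^ 2 + (v q).2 ^ 2)) * q.1⁻¹)
      (contDiff_mul_inv_fst_of_eq_zero h.contDiff_sqrt hr₀ fun q hq => by
        simp [(h0 q hq).1, (h0 q hq).2]) hr₀
      fun q hq => by simp [(h0 q hq).1, (h0 q hq).2]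
  have hJ : ContDiff ℝ ∞ (rotGen : EuclideanSpace ℝ (Fin 3) → EuclideanSpace ℝ (Fin 3)) :=
    rotGenL.contDiff
  rw [swirlField_eq_linear]
  exact ((hα.smul contDiff_horizontal).add (hβ.smul contDiff_const)).add (hγ.smul hJ)

/-- Off `R(Ū)` the field of a structure vanishes.
[cite: Ozanski2017NSISingular, §3.4 (after Definition 3.3)] -/
theorem swirlField_eq_zero (h : IsNSIStructure U v f φ) {x : EuclideanSpace ℝ (Fin 3)}
    (hx : meridian x ∉ closure U) : swirlField v f x = 0 := by
  have hf := h.f_eq_zero hx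
  have hv := h.v_eq_zero hx
  simp only [swirlField]
  rw [hf, hv]
  simp

/-- **`supp u[v,f] ⊆ R(Ū)`** for a structure (Ożański, after Definition 3.3: "`u[v,f]` … is
supported in `R(Ū)`"). [cite: Ozanski2017NSISingular, §3.4 (after Definition 3.3)] -/
theorem tsupport_swirlField_subset (h : IsNSIStructure U v f φ) :
    tsupport (swirlField v f) ⊆ revolve (closure U) := by
  refine closure_minimal (fun x hx => ?_) (isClosed_closure.preimage continuous_meridian)
  by_contra hx'
  exact hx (h.swirlField_eq_zero hx')

/-- `u[v,f]` has compact support. [cite: Ozanski2017NSISingular, §3.3 (after (3.12))] -/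
theorem hasCompactSupport_swirlField (h : IsNSIStructure U v f φ) :
    HasCompactSupport (swirlField v f) :=
  (isCompact_revolve h.isCompact_closure).of_isClosed_subset (isClosed_tsupport _)
    h.tsupport_swirlField_subset

/-- Near the axis (`r < r₀`, the margin of the structure) the field vanishes. [folklore] -/
theorem swirlField_eq_zero_of_lt (h : IsNSIStructure U v f φ) {r₀ : ℝ}
    (hr : ∀ q ∈ closure U, r₀ ≤ q.1) {x : EuclideanSpace ℝ (Fin 3)} (hx : cylRadius x < r₀) :
    swirlField v f x = 0 :=
  h.swirlField_eq_zero fun h' => (hr _ h').not_gt hx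

end IsNSIStructure

/-! ### Divergence (Lemma 3.1 (i)) -/

section Divergence

/-- `div (v + w) = div v + div w` at points of differentiability. [folklore] -/
private theorem divergence_add_apply' {v w : EuclideanSpace ℝ (Fin 3) → EuclideanSpace ℝ (Fin 3)}
    {x : EuclideanSpace ℝ (Fin 3)} (hv : DifferentiableAt ℝ v x) (hw : DifferentiableAt ℝ w x) :
    VectorCalculus.divergence (fun y => v y + w y) x =
      VectorCalculus.divergence v x + VectorCalculus.divergence w x := by
  simp only [VectorCalculus.divergence, fderiv_fun_add hv hw, ContinuousLinearMap.toLinearMap_add,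
    map_add]

/-- The horizontal projection is the continuous linear map `y ↦ y - y₂ x̂_axis`. [folklore] -/
theorem horizontal_eq_clm (y : EuclideanSpace ℝ (Fin 3)) :
    (toLp 2 ![y 0, y 1, 0] : EuclideanSpace ℝ (Fin 3)) =
      (ContinuousLinearMap.id ℝ (EuclideanSpace ℝ (Fin 3)) -
        (EuclideanSpace.proj (2 : Fin 3) : EuclideanSpace ℝ (Fin 3) →L[ℝ] ℝ).smulRight eZ) y := by
  ext i
  fin_cases i <;> simp [eZ]

/-- `div (x₀, x₁, 0) = 2`. [folklore] -/
theorem divergence_horizontal (x : EuclideanSpace ℝ (Fin 3)) :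
    VectorCalculus.divergence (fun y : EuclideanSpace ℝ (Fin 3) =>
      (toLp 2 ![y 0, y 1, 0] : EuclideanSpace ℝ (Fin 3))) x = 2 := by
  have heq : (fun y : EuclideanSpace ℝ (Fin 3) =>
      (toLp 2 ![y 0, y 1, 0] : EuclideanSpace ℝ (Fin 3))) =
      ⇑(ContinuousLinearMap.id ℝ (EuclideanSpace ℝ (Fin 3)) -
        (EuclideanSpace.proj (2 : Fin 3) : EuclideanSpace ℝ (Fin 3) →L[ℝ] ℝ).smulRight eZ) :=
    funext horizontal_eq_clm
  rw [heq, divergence_eq_sum_inner_fderiv (EuclideanSpace.basisFun (Fin 3) ℝ),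
    ContinuousLinearMap.fderiv]
  simp [Fin.sum_univ_three, EuclideanSpace.inner_single_left, eZ]
  norm_num

/-- `div J = 0` for the infinitesimal rotation `Jx = (-x₁, x₀, 0)`. [folklore] -/
theorem divergence_rotGen (x : EuclideanSpace ℝ (Fin 3)) :
    VectorCalculus.divergence rotGen x = 0 := by
  rw [divergence_eq_sum_inner_fderiv (EuclideanSpace.basisFun (Fin 3) ℝ),
    (hasFDerivAt_rotGen x).fderiv]
  simp [Fin.sum_univ_three, EuclideanSpace.inner_single_left, rotGen]

/-- `⟪ρ̂, Jx⟫ = 0`. [folklore] -/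
theorem inner_eR_rotGen (x : EuclideanSpace ℝ (Fin 3)) : ⟪eR x, rotGen x⟫ = 0 := by
  have : ⟪(toLp 2 ![x 0, x 1, 0] : EuclideanSpace ℝ (Fin 3)), rotGen x⟫ = 0 := by
    simp [rotGen, PiLp.inner_apply, Fin.sum_univ_three]
    ring
  rw [eR, inner_smul_left, this, mul_zero]

/-- `⟪ρ̂, (x₀,x₁,0)⟫ = r`. [folklore] -/
theorem inner_eR_horizontal (x : EuclideanSpace ℝ (Fin 3)) :
    ⟪eR x, (toLp 2 ![x 0, x 1, 0] : EuclideanSpace ℝ (Fin 3))⟫ = cylRadius x := by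
  have hr := cylRadius_sq x
  by_cases hx : cylRadius x = 0
  · obtain ⟨h0, h1⟩ := (cylRadius_eq_zero_iff x).1 hx
    simp [eR, hx, h0, h1]
  · simp only [eR, inner_smul_left, PiLp.inner_apply, RCLike.inner_apply, conj_trivial,
      Fin.sum_univ_three, Matrix.cons_val_zero, Matrix.cons_val_one,
      Matrix.cons_val_two, Matrix.head_cons, Matrix.tail_cons, map_inv₀]
    field_simp
    linear_combination -hr

/-- The gradient pairing of a lifted profile: `D(G ∘ meridian)(x) w = DG(q)(⟪ρ̂, w⟫, w₂)`,
specialised to `w = (x₀,x₁,0)`: `= r ∂ᵣG`. [folklore] -/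
theorem fderiv_comp_meridian_horizontal {G : ℝ × ℝ → ℝ} {x : EuclideanSpace ℝ (Fin 3)}
    (hx : cylRadius x ≠ 0) (hG : DifferentiableAt ℝ G (meridian x)) :
    fderiv ℝ (fun y => G (meridian y)) x (toLp 2 ![x 0, x 1, 0]) =
      cylRadius x * derivR G (meridian x) := by
  rw [fderiv_comp_meridian_apply hx hG, inner_eR_horizontal, derivR]
  have : ((cylRadius x, (toLp 2 ![x 0, x 1, 0] : EuclideanSpace ℝ (Fin 3)) 2) : ℝ × ℝ) =
      cylRadius x • ((1 : ℝ), (0 : ℝ)) := by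
    ext <;> simp
  rw [this, map_smul, smul_eq_mul]

/-- Along `Jx` a lifted profile has zero derivative: `D(G ∘ meridian)(x)(Jx) = 0`. [folklore] -/
theorem fderiv_comp_meridian_rotGen {G : ℝ × ℝ → ℝ} {x : EuclideanSpace ℝ (Fin 3)}
    (hx : cylRadius x ≠ 0) (hG : DifferentiableAt ℝ G (meridian x)) :
    fderiv ℝ (fun y => G (meridian y)) x (rotGen x) = 0 := by
  rw [fderiv_comp_meridian_apply hx hG, inner_eR_rotGen, rotGen_apply_two, Prod.mk_zero_zero,
    map_zero]

/-- Along `x̂_axis`: `D(G ∘ meridian)(x)(e_z) = ∂_zG`. [folklore] -/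
theorem fderiv_comp_meridian_eZ {G : ℝ × ℝ → ℝ} {x : EuclideanSpace ℝ (Fin 3)}
    (hx : cylRadius x ≠ 0) (hG : DifferentiableAt ℝ G (meridian x)) :
    fderiv ℝ (fun y => G (meridian y)) x eZ = derivZ G (meridian x) := by
  rw [fderiv_comp_meridian_apply hx hG, inner_eR_eZ, derivZ]
  simp [eZ]

/-- **Leibniz + chain rule for a lifted profile times a linear field**: if `W` is linear with
`div W = c` (constant), then off the axis
`div (G∘meridian · W)(x) = c G(q) + DG(q)(⟪ρ̂, Wx⟫, (Wx)₂)`. [folklore] -/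
theorem divergence_comp_meridian_smul {G : ℝ × ℝ → ℝ}
    {W : EuclideanSpace ℝ (Fin 3) → EuclideanSpace ℝ (Fin 3)} {x : EuclideanSpace ℝ (Fin 3)}
    (hx : cylRadius x ≠ 0) (hG : DifferentiableAt ℝ G (meridian x)) (hW : DifferentiableAt ℝ W x) :
    VectorCalculus.divergence (fun y => G (meridian y) • W y) x =
      G (meridian x) * VectorCalculus.divergence W x +
        fderiv ℝ (fun y => G (meridian y)) x (W x) := by
  rw [divergence_smul_apply (differentiableAt_comp_meridian hx hG) hW, real_inner_comm, gradient,
    InnerProductSpace.toDual_symm_apply]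

/-- **Lemma 3.1 (i), the divergence of `u[v,f]`** off the axis:
`div u[v,f](x) = v_r(q)/r + ∂ᵣv_r(q) + ∂_z v_z(q)`, `q = meridian x` (the swirl component and the
profile `√(f²-|v|²)` do not contribute: `div(φ̂) = 0`, `∂_φ` of axisymmetric profiles vanishes),
for planar data differentiable at `q`. [cite: Ozanski2017NSISingular, Lemma 3.1 (i)] -/
theorem divergence_swirlField {v : ℝ × ℝ → ℝ × ℝ} {f : ℝ × ℝ → ℝ} {x : EuclideanSpace ℝ (Fin 3)}
    (hx : cylRadius x ≠ 0) (hv : DifferentiableAt ℝ v (meridian x))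
    (hw : DifferentiableAt ℝ (fun q => Real.sqrt (f q ^ 2 - ((v q).1 ^ 2 + (v q).2 ^ 2)))
      (meridian x)) :
    VectorCalculus.divergence (swirlField v f) x =
      (v (meridian x)).1 * (cylRadius x)⁻¹ + derivR (fun q => (v q).1) (meridian x) +
        derivZ (fun q => (v q).2) (meridian x) := by
  set q := meridian x with hq
  have hq1 : q.1 = cylRadius x := rfl
  have hinv : DifferentiableAt ℝ (fun q' : ℝ × ℝ => q'.1⁻¹) q := differentiableAt_fst.inv (hq1 ▸ hx)
  have hv1 : DifferentiableAt ℝ (fun q' => (v q').1) q := differentiableAt_fst.comp _ hv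
  have hv2 : DifferentiableAt ℝ (fun q' => (v q').2) q := differentiableAt_snd.comp _ hv
  have hα : DifferentiableAt ℝ (fun q' => (v q').1 * q'.1⁻¹) q := hv1.mul hinv
  have hγ : DifferentiableAt ℝ
      (fun q' => Real.sqrt (f q' ^ 2 - ((v q').1 ^ 2 + (v q').2 ^ 2)) * q'.1⁻¹) q := hw.mul hinv
  have hH : DifferentiableAt ℝ (fun y : EuclideanSpace ℝ (Fin 3) =>
      (toLp 2 ![y 0, y 1, 0] : EuclideanSpace ℝ (Fin 3))) x :=
    (contDiff_horizontal (n := 1)).differentiable one_ne_zero x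
  have hJ : DifferentiableAt ℝ rotGen x := (hasFDerivAt_rotGen x).differentiableAt
  -- the three summands
  have h1 : VectorCalculus.divergence (fun y : EuclideanSpace ℝ (Fin 3) =>
      ((v (meridian y)).1 * (meridian y).1⁻¹) •
        (toLp 2 ![y 0, y 1, 0] : EuclideanSpace ℝ (Fin 3))) x =
      2 * ((v q).1 * q.1⁻¹) + cylRadius x * derivR (fun q' => (v q').1 * q'.1⁻¹) q := by
    rw [divergence_comp_meridian_smul (G := fun q' => (v q').1 * q'.1⁻¹) hx hα hH,
      divergence_horizontal, fderiv_comp_meridian_horizontal hx hα]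
    ring
  have h2 : VectorCalculus.divergence (fun y : EuclideanSpace ℝ (Fin 3) =>
      (v (meridian y)).2 • eZ) x = derivZ (fun q' => (v q').2) q := by
    rw [divergence_comp_meridian_smul (G := fun q' => (v q').2) hx hv2
      (differentiableAt_const _), fderiv_comp_meridian_eZ hx hv2]
    have : VectorCalculus.divergence (fun _ : EuclideanSpace ℝ (Fin 3) => eZ) x = 0 := by
      simp [VectorCalculus.divergence]
    rw [this, mul_zero, zero_add]
  have h3 : VectorCalculus.divergence (fun y : EuclideanSpace ℝ (Fin 3) =>
      (Real.sqrt (f (meridian y) ^ 2 - ((v (meridian y)).1 ^ 2 + (v (meridian y)).2 ^ 2)) *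
        (meridian y).1⁻¹) • rotGen y) x = 0 := by
    rw [divergence_comp_meridian_smul
      (G := fun q' => Real.sqrt (f q' ^ 2 - ((v q').1 ^ 2 + (v q').2 ^ 2)) * q'.1⁻¹) hx hγ hJ,
      divergence_rotGen, fderiv_comp_meridian_rotGen hx hγ]
    ring
  -- the derivative of the profile `α = v_r / r`
  have hdα : derivR (fun q' => (v q').1 * q'.1⁻¹) q =
      derivR (fun q' => (v q').1) q * q.1⁻¹ - (v q).1 * (q.1 ^ 2)⁻¹ := by
    simp only [derivR]
    rw [fderiv_fun_mul hv1 hinv]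
    have hfst : fderiv ℝ (fun q' : ℝ × ℝ => q'.1⁻¹) q ((1 : ℝ), (0 : ℝ)) = -(q.1 ^ 2)⁻¹ := by
      have hd : HasFDerivAt (fun q' : ℝ × ℝ => q'.1⁻¹)
          ((ContinuousLinearMap.smulRight (1 : ℝ →L[ℝ] ℝ) (-(q.1 ^ 2)⁻¹)).comp
            (ContinuousLinearMap.fst ℝ ℝ ℝ)) q :=
        (hasFDerivAt_inv (hq1 ▸ hx)).comp q hasFDerivAt_fst
      rw [hd.fderiv]
      simp
    simp [hfst]
    ring
  -- assemble
  have hdA : DifferentiableAt ℝ (fun y : EuclideanSpace ℝ (Fin 3) =>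
      ((v (meridian y)).1 * (meridian y).1⁻¹) •
        (toLp 2 ![y 0, y 1, 0] : EuclideanSpace ℝ (Fin 3))) x :=
    (differentiableAt_comp_meridian hx hα).smul hH
  have hdB : DifferentiableAt ℝ (fun y : EuclideanSpace ℝ (Fin 3) => (v (meridian y)).2 • eZ) x :=
    (differentiableAt_comp_meridian hx hv2).smul (differentiableAt_const _)
  have hd12 : DifferentiableAt ℝ (fun y : EuclideanSpace ℝ (Fin 3) =>
      ((v (meridian y)).1 * (meridian y).1⁻¹) •
        (toLp 2 ![y 0, y 1, 0] : EuclideanSpace ℝ (Fin 3)) + (v (meridian y)).2 • eZ) x :=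
    hdA.add hdB
  have hd3 : DifferentiableAt ℝ (fun y : EuclideanSpace ℝ (Fin 3) =>
      (Real.sqrt (f (meridian y) ^ 2 - ((v (meridian y)).1 ^ 2 + (v (meridian y)).2 ^ 2)) *
        (meridian y).1⁻¹) • rotGen y) x :=
    (differentiableAt_comp_meridian hx hγ).smul hJ
  rw [swirlField_eq_linear, divergence_add_apply' hd12 hd3, divergence_add_apply' hdA hdB, h1, h2,
    h3, hdα, hq1]
  field_simp
  ring

/-- **`div u[v,f] = 0` for a structure** (Ożański, after Definition 3.3: "the velocity field
`u[v,f]` is divergence free", by Lemma 3.1 (i) and `div(x₂ v) = 0`). Off the axis this is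
`divergence_swirlField` combined with `∂ᵣ(r v_r) + ∂_z(r v_z) = r · div u[v,f]`; near the axis
`u[v,f] ≡ 0`. [cite: Ozanski2017NSISingular, Lemma 3.1 (i) and §3.4 (after Definition 3.3)] -/
theorem IsNSIStructure.isDivFree_swirlField (h : IsNSIStructure U v f φ) :
    VectorCalculus.IsDivFree (swirlField v f) := by
  intro x
  obtain ⟨r₀, hr₀, hr⟩ := h.exists_axis_margin
  by_cases hx : cylRadius x < r₀
  · -- `u ≡ 0` on the open neighbourhood `{r < r₀}` of `x`
    apply divergence_eq_zero_of_notMem_tsupport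
    intro hx'
    have := h.tsupport_swirlField_subset hx'
    exact (hr _ this).not_gt hx
  · have hx0 : cylRadius x ≠ 0 := fun h0 => hx (h0 ▸ hr₀)
    set q := meridian x with hq
    have hvd : Differentiable ℝ v := h.v_smooth.differentiable (by simp)
    have hv1 : DifferentiableAt ℝ (fun q' => (v q').1) q := differentiableAt_fst.comp _ (hvd q)
    have hv2 : DifferentiableAt ℝ (fun q' => (v q').2) q := differentiableAt_snd.comp _ (hvd q)
    rw [divergence_swirlField hx0 (hvd q) (h.contDiff_sqrt.differentiable (by simp) q)]
    by_cases hqU : q ∈ U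
    · -- the structure's `∂ᵣ(r v_r) + ∂_z(r v_z) = 0`, expanded by the product rule
      have key := h.div_eq_zero q hqU
      simp only [derivR, derivZ] at key ⊢
      rw [fderiv_fun_mul differentiableAt_fst hv1, fderiv_fun_mul differentiableAt_fst hv2,
        fderiv_fst] at key
      have hq1 : q.1 = cylRadius x := rfl
      have hq0 : q.1 ≠ 0 := hq1 ▸ hx0
      rw [← hq1]
      simp at key
      field_simp
      linear_combination key
    · -- off `U` (hence off `supp v`): `v ≡ 0` near `q`
      have hq' : q ∉ tsupport v := fun h' => hqU (h.tsupport_v_subset h')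
      have hv0 : ∀ᶠ q' in 𝓝 q, v q' = 0 := by
        filter_upwards [(isClosed_tsupport v).isOpen_compl.mem_nhds hq'] with q' hq''
        exact image_eq_zero_of_notMem_tsupport hq''
      have e1 : (fun q' => (v q').1) =ᶠ[𝓝 q] fun _ => (0 : ℝ) := hv0.mono fun q' hq'' => by
        simp [hq'']
      have e2 : (fun q' => (v q').2) =ᶠ[𝓝 q] fun _ => (0 : ℝ) := hv0.mono fun q' hq'' => by
        simp [hq'']
      simp only [derivR, derivZ]
      rw [e1.fderiv_eq, e2.fderiv_eq, image_eq_zero_of_notMem_tsupport hq']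
      simp

end Divergence

end Literature.Barriers.NavierStokesRegularity
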